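import Mathlib

/-!
# Route `KPlusLogSqLaw`, crux `TropicalB` (stmt-ValiantsHypothesis-19771) — the 2-DEFICIENT COVER EXCHANGE LEMMA and the COLLISION LAW
# for «position gadgets» (why an inner block cannot read an outer block's bit through column availability without admitting collisions)

HONEST FRAMING.  Helper file (cell `pub-symmetroid`, seat val-sym-trop-p5 g27, refuter-adjacent lane, 2026-08-29; `--supports
stmt-ValiantsHypothesis-19771 --as helper`).  PURE COMBINATORICS of injective maps between finite types (no design, no `IsDominant`, no census
constant in any type): an exchange lemma for «covers» of a column set missing exactly two columns, and its corollary used in the seat's memo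
LEX-PRODUCT-g27.md §1 (evidence #60 on 19771) to close a class of lower-bound ARCHITECTURES for the crux (odometer designs in which an inner
shifted block reads the outer block's state through a per-position gadget).  Nothing here bounds `TropicalB`, and nothing bears on `WeakLifting`,
DoorA26 / DoorA34, `MatrixDescartes` (stmt-ValiantsHypothesis-18050) or VP ≠ VNP.

THE LEMMA (`cover_exchange`).  Rows `R`, columns `C` (finite), two injective maps `f₀ f₁ : R → C` («covers»: in a perfect matching of a design,
the internal rows of a gadget are matched into the gadget's own columns, all but the two taken by external rows), `f₀` avoiding the columns
`p ≠ q`, `f₁` avoiding `r ≠ s`, with `r ∉ {p, q}` covered by `f₀` (`∃ i, f₀ i = r`, automatic when `|C| = |R| + 2`).  Follow the alternating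
walk `r = c₀, c₁, …` (`c_{k+1} = f₁ (f₀⁻¹ c_k)`) until it leaves the range of `f₀`, i.e. reaches `p` or `q` (it cannot cycle: `c_{k+1}` lies in
the range of `f₁`, which misses `r`); swapping `f₀`/`f₁` on the rows `S` of the walk gives two injective ROW-WISE MIXTURES
`g₀ = (f₁ on S, f₀ off S)`, `g₁ = (f₀ on S, f₁ off S)` with `(g₀, g₁)` avoiding `({q, r}, {p, s})` if the walk exits at `p` and
`({p, r}, {q, s})` if it exits at `q`.  Row-wise mixtures keep every row-wise admissibility predicate (`mix_ok`) and the total cost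
(`mix_cost`: `Σ cost(g₀) + Σ cost(g₁) = Σ cost(f₀) + Σ cost(f₁)`).

THE COLLISION LAW (`collision_law`).  Read `p = x⁰, r = x¹` (the outer block's two port columns at a position: which one it takes is the bit)
and `q = yᵃ, s = yᵇ` (the inner block's two port columns: which one is left free is what it reads).  If the gadget realises the two intended
patterns — an admissible cover avoiding `{x⁰, yᵃ}` and one avoiding `{x¹, yᵇ}` — but NO admissible cover avoids the crossed pair `{x¹, yᵃ}`
(the inner port is determined by the outer one), then it realises both COLLISION patterns: admissible covers avoiding `{x⁰, x¹}` (two outer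
rows at this position) and `{yᵃ, yᵇ}` (two inner rows), with the SAME total cost as the two intended covers.  Applied to optimal covers in
both directions (the lemma is symmetric), min-cost(x⁰yᵃ) + min-cost(x¹yᵇ) = min-cost(x⁰x¹) + min-cost(yᵃyᵇ): collisions are feasible and
cost-neutral inside every reading gadget, so they can only be priced by the blocks' own potentials — which at the seam of a cyclic block is
one-sided (memo §1.3).  Matroid reading (not formalised): realisable port patterns are the bases of the dual transversal matroid and the cost
identity is its rank-2 tropical Plücker relation.  [folklore: alternating-path exchange for bipartite matchings (König–Egerváry / basis
exchange in transversal matroids, Edmonds–Fulkerson 1965); the packaging for dominance designs is this seat's]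
-/

set_option linter.dupNamespace false
set_option autoImplicit false

namespace Summit.ValiantsHypothesis.ValiantsHypothesis.Theorems.KPlusLogSqLaw

namespace CoverExchange

open Finset

variable {R C : Type*} [Fintype R] [Fintype C] [DecidableEq R] [DecidableEq C]

omit [Fintype R] [Fintype C] [DecidableEq C] in
/-- row-wise mixtures keep row-wise admissibility. [folklore] -/
theorem mix_ok (ok : R → C → Prop) (f₀ f₁ : R → C) (h₀ : ∀ i, ok i (f₀ i)) (h₁ : ∀ i, ok i (f₁ i))
    (S : Finset R) (i : R) : ok i (if i ∈ S then f₁ i else f₀ i) := by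
  split_ifs
  · exact h₁ i
  · exact h₀ i

omit [Fintype C] [DecidableEq C] in
/-- row-wise mixtures keep the total cost: `Σ cost(g₀) + Σ cost(g₁) = Σ cost(f₀) + Σ cost(f₁)`. [folklore] -/
theorem mix_cost (cost : R → C → ℤ) (f₀ f₁ : R → C) (S : Finset R) :
    ∑ i, cost i (if i ∈ S then f₁ i else f₀ i) + ∑ i, cost i (if i ∈ S then f₀ i else f₁ i) =
      ∑ i, cost i (f₀ i) + ∑ i, cost i (f₁ i) := by
  rw [← sum_add_distrib, ← sum_add_distrib]
  refine sum_congr rfl fun i _ => ?_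
  split_ifs <;> ring

omit [Fintype R] in
/-- **2-deficient cover exchange.**  `f₀` injective avoiding `p ≠ q`, `f₁` injective avoiding `r ≠ s`, `r` covered by `f₀`; then for some
row set `S` the two row-wise mixtures are injective and avoid `({q,r},{p,s})` or `({p,r},{q,s})`. [folklore: alternating-path exchange] -/
theorem cover_exchange (f₀ f₁ : R → C) (hf₀ : Function.Injective f₀) (hf₁ : Function.Injective f₁)
    (p q r s : C) (hpq : p ≠ q) (hrs : r ≠ s)
    (h₀p : ∀ i, f₀ i ≠ p) (h₀q : ∀ i, f₀ i ≠ q) (h₀sur : ∀ c, c ≠ p → c ≠ q → ∃ i, f₀ i = c)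
    (h₁r : ∀ i, f₁ i ≠ r) (h₁s : ∀ i, f₁ i ≠ s) (hr : ∃ i, f₀ i = r) :
    ∃ S : Finset R,
      Function.Injective (fun i => if i ∈ S then f₁ i else f₀ i) ∧
      Function.Injective (fun i => if i ∈ S then f₀ i else f₁ i) ∧
      (((∀ i, (if i ∈ S then f₁ i else f₀ i) ≠ q ∧ (if i ∈ S then f₁ i else f₀ i) ≠ r) ∧
          (∀ i, (if i ∈ S then f₀ i else f₁ i) ≠ p ∧ (if i ∈ S then f₀ i else f₁ i) ≠ s)) ∨
        ((∀ i, (if i ∈ S then f₁ i else f₀ i) ≠ p ∧ (if i ∈ S then f₁ i else f₀ i) ≠ r) ∧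
          (∀ i, (if i ∈ S then f₀ i else f₁ i) ≠ q ∧ (if i ∈ S then f₀ i else f₁ i) ≠ s))) := by
  classical
  obtain ⟨i_r, hi_r⟩ := hr
  have hrp : r ≠ p := fun h => h₀p i_r (hi_r.trans h)
  have hrq : r ≠ q := fun h => h₀q i_r (hi_r.trans h)
  -- a preimage section of `f₀` on `C \ {p, q}`
  let pre : C → R := fun c => if h : c ≠ p ∧ c ≠ q then Classical.choose (h₀sur c h.1 h.2) else i_r
  have hpre : ∀ c, c ≠ p → c ≠ q → f₀ (pre c) = c := by
    intro c hp hq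
    simp only [pre, dif_pos (And.intro hp hq)]
    exact Classical.choose_spec (h₀sur c hp hq)
  -- the alternating walk
  let step : C → C := fun c => if c ≠ p ∧ c ≠ q then f₁ (pre c) else c
  let col : ℕ → C := fun k => step^[k] r
  have col_zero : col 0 = r := rfl
  have col_succ : ∀ k, col k ≠ p → col k ≠ q → col (k + 1) = f₁ (pre (col k)) := by
    intro k hp hq
    show step^[k + 1] r = _
    rw [Function.iterate_succ_apply']
    show step (col k) = _
    simp only [step, if_pos (And.intro hp hq)]
  -- before exiting, the walk never returns to `r` and never repeats
  have col_succ_ne_r : ∀ k, col k ≠ p → col k ≠ q → col (k + 1) ≠ r := by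
    intro k hp hq h
    rw [col_succ k hp hq] at h
    exact h₁r _ h
  have col_inj : ∀ d a : ℕ, (∀ j, j ≤ a + d → col j ≠ p ∧ col j ≠ q) → col a ≠ col (a + d + 1) := by
    intro d a
    induction a with
    | zero =>
      intro hP h
      have h' := col_succ_ne_r d (hP d (by omega)).1 (hP d (by omega)).2
      rw [col_zero] at h
      exact h' (by rw [show 0 + d + 1 = d + 1 by ring] at h; exact h.symm)
    | succ a ih =>
      intro hP h
      have ha := hP a (by omega)
      have had := hP (a + d + 1) (by omega)
      rw [col_succ a ha.1 ha.2, show a + 1 + d + 1 = (a + d + 1) + 1 by ring, col_succ (a + d + 1) had.1 had.2] at h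
      have h2 := hf₁ h
      have h3 : f₀ (pre (col a)) = f₀ (pre (col (a + d + 1))) := by rw [h2]
      rw [hpre _ ha.1 ha.2, hpre _ had.1 had.2] at h3
      exact ih (fun j hj => hP j (by omega)) h3
  -- hence the walk exits through `{p, q}`
  have hexit : ∃ k, col k = p ∨ col k = q := by
    by_contra hcon
    push Not at hcon
    have hinj : Function.Injective fun k : Fin (Fintype.card C + 1) => col k := by
      intro a b h
      rcases lt_trichotomy (a : ℕ) b with hab | hab | hab
      · exfalso
        have := col_inj ((b : ℕ) - a - 1) a (fun j _ => hcon j)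
        rw [show (a : ℕ) + ((b : ℕ) - a - 1) + 1 = b by omega] at this
        exact this h
      · exact Fin.ext hab
      · exfalso
        have := col_inj ((a : ℕ) - b - 1) b (fun j _ => hcon j)
        rw [show (b : ℕ) + ((a : ℕ) - b - 1) + 1 = a by omega] at this
        exact this h.symm
    have := Fintype.card_le_of_injective _ hinj
    simp at this
  let t := Nat.find hexit
  have ht : col t = p ∨ col t = q := Nat.find_spec hexit
  have hlt : ∀ j, j < t → col j ≠ p ∧ col j ≠ q := fun j hj => by
    have := Nat.find_min hexit hj
    push Not at this
    exact this
  have ht1 : 1 ≤ t := by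
    rcases Nat.eq_zero_or_pos t with h0 | h0
    · exfalso
      have h' : col 0 = p ∨ col 0 = q := by rw [← h0]; exact ht
      rw [col_zero] at h'
      rcases h' with h' | h'
      · exact hrp h'
      · exact hrq h'
    · exact h0
  -- the rows of the walk
  let S : Finset R := (range t).image fun k => pre (col k)
  have f₀_pre : ∀ k, k < t → f₀ (pre (col k)) = col k := fun k hk => hpre _ (hlt k hk).1 (hlt k hk).2
  have f₁_pre : ∀ k, k < t → f₁ (pre (col k)) = col (k + 1) := fun k hk =>
    (col_succ k (hlt k hk).1 (hlt k hk).2).symm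
  have mem_S : ∀ i, i ∈ S ↔ ∃ k, k < t ∧ f₀ i = col k := by
    intro i
    constructor
    · intro hi
      obtain ⟨k, hk, rfl⟩ := mem_image.mp hi
      exact ⟨k, mem_range.mp hk, f₀_pre k (mem_range.mp hk)⟩
    · rintro ⟨k, hk, hik⟩
      have : i = pre (col k) := hf₀ (hik.trans (f₀_pre k hk).symm)
      rw [this]
      exact mem_image.mpr ⟨k, mem_range.mpr hk, rfl⟩
  have f₁_of_mem : ∀ i k, k < t → f₀ i = col k → f₁ i = col (k + 1) := by
    intro i k hk hik
    have : i = pre (col k) := hf₀ (hik.trans (f₀_pre k hk).symm)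
    rw [this]; exact f₁_pre k hk
  refine ⟨S, ?_, ?_, ?_⟩
  · -- `g₀ = (f₁ on S, f₀ off S)` is injective
    intro i i' h
    simp only at h
    by_cases hi : i ∈ S <;> by_cases hi' : i' ∈ S
    · rw [if_pos hi, if_pos hi'] at h; exact hf₁ h
    · rw [if_pos hi, if_neg hi'] at h
      exfalso
      obtain ⟨k, hk, hik⟩ := (mem_S i).mp hi
      rw [f₁_of_mem i k hk hik] at h
      rcases Nat.lt_or_ge (k + 1) t with hk1 | hk1
      · exact hi' ((mem_S i').mpr ⟨k + 1, hk1, h.symm⟩)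
      · have hkt : k + 1 = t := by omega
        rw [hkt] at h
        rcases ht with h' | h'
        · exact h₀p i' (h.symm.trans h')
        · exact h₀q i' (h.symm.trans h')
    · rw [if_neg hi, if_pos hi'] at h
      exfalso
      obtain ⟨k, hk, hik⟩ := (mem_S i').mp hi'
      rw [f₁_of_mem i' k hk hik] at h
      rcases Nat.lt_or_ge (k + 1) t with hk1 | hk1
      · exact hi ((mem_S i).mpr ⟨k + 1, hk1, h⟩)
      · have hkt : k + 1 = t := by omega
        rw [hkt] at h
        rcases ht with h' | h'
        · exact h₀p i (h.trans h')
        · exact h₀q i (h.trans h')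
    · rw [if_neg hi, if_neg hi'] at h; exact hf₀ h
  · -- `g₁ = (f₀ on S, f₁ off S)` is injective
    intro i i' h
    simp only at h
    by_cases hi : i ∈ S <;> by_cases hi' : i' ∈ S
    · rw [if_pos hi, if_pos hi'] at h; exact hf₀ h
    · rw [if_pos hi, if_neg hi'] at h
      exfalso
      obtain ⟨k, hk, hik⟩ := (mem_S i).mp hi
      rw [hik] at h
      rcases Nat.eq_zero_or_pos k with hk0 | hk0
      · rw [hk0, col_zero] at h
        exact h₁r i' h.symm
      · obtain ⟨k', rfl⟩ : ∃ k', k = k' + 1 := ⟨k - 1, by omega⟩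
        rw [← f₁_pre k' (by omega)] at h
        have hi'eq : i' = pre (col k') := hf₁ h.symm
        exact hi' ((mem_S i').mpr ⟨k', by omega, by rw [hi'eq]; exact f₀_pre k' (by omega)⟩)
    · rw [if_neg hi, if_pos hi'] at h
      exfalso
      obtain ⟨k, hk, hik⟩ := (mem_S i').mp hi'
      rw [hik] at h
      rcases Nat.eq_zero_or_pos k with hk0 | hk0
      · rw [hk0, col_zero] at h
        exact h₁r i h
      · obtain ⟨k', rfl⟩ : ∃ k', k = k' + 1 := ⟨k - 1, by omega⟩
        rw [← f₁_pre k' (by omega)] at h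
        have hieq : i = pre (col k') := hf₁ h
        exact hi ((mem_S i).mpr ⟨k', by omega, by rw [hieq]; exact f₀_pre k' (by omega)⟩)
    · rw [if_neg hi, if_neg hi'] at h; exact hf₁ h
  · -- avoided columns, read off the two ends of the walk
    -- `g₀` avoids `r`
    have g₀r : ∀ i, (if i ∈ S then f₁ i else f₀ i) ≠ r := by
      intro i h
      by_cases hi : i ∈ S
      · rw [if_pos hi] at h; exact h₁r i h
      · rw [if_neg hi] at h
        exact hi ((mem_S i).mpr ⟨0, ht1, by rw [col_zero]; exact h⟩)
    -- `g₀` avoids the element of `{p, q}` other than the exit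
    have g₀o : ∀ o, (o = p ∨ o = q) → col t ≠ o → ∀ i, (if i ∈ S then f₁ i else f₀ i) ≠ o := by
      intro o ho hto i h
      by_cases hi : i ∈ S
      · rw [if_pos hi] at h
        obtain ⟨k, hk, hik⟩ := (mem_S i).mp hi
        rw [f₁_of_mem i k hk hik] at h
        rcases Nat.lt_or_ge (k + 1) t with hk1 | hk1
        · rcases ho with rfl | rfl
          · exact (hlt _ hk1).1 h
          · exact (hlt _ hk1).2 h
        · have hkt : k + 1 = t := by omega
          rw [hkt] at h
          exact hto h
      · rw [if_neg hi] at h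
        rcases ho with rfl | rfl
        · exact h₀p i h
        · exact h₀q i h
    -- `g₁` avoids `s`
    have g₁s : ∀ i, (if i ∈ S then f₀ i else f₁ i) ≠ s := by
      intro i h
      by_cases hi : i ∈ S
      · rw [if_pos hi] at h
        obtain ⟨k, hk, hik⟩ := (mem_S i).mp hi
        rw [hik] at h
        rcases Nat.eq_zero_or_pos k with hk0 | hk0
        · rw [hk0, col_zero] at h; exact hrs h
        · obtain ⟨k', rfl⟩ : ∃ k', k = k' + 1 := ⟨k - 1, by omega⟩
          rw [← f₁_pre k' (by omega)] at h
          exact h₁s _ h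
      · rw [if_neg hi] at h; exact h₁s i h
    -- `g₁` avoids the exit
    have g₁e : ∀ i, (if i ∈ S then f₀ i else f₁ i) ≠ col t := by
      intro i h
      by_cases hi : i ∈ S
      · rw [if_pos hi] at h
        rcases ht with h' | h'
        · exact h₀p i (h.trans h')
        · exact h₀q i (h.trans h')
      · rw [if_neg hi] at h
        obtain ⟨t', ht'⟩ : ∃ t', t = t' + 1 := ⟨t - 1, by omega⟩
        have hlt' : t' < t := by omega
        have e1 : col t = f₁ (pre (col t')) := by rw [ht']; exact (f₁_pre t' hlt').symm
        rw [e1] at h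
        have hieq : i = pre (col t') := hf₁ h
        exact hi ((mem_S i).mpr ⟨t', hlt', by rw [hieq]; exact f₀_pre t' hlt'⟩)
    rcases ht with hp' | hq'
    · -- exit at `p`: `(g₀, g₁)` avoid `({q, r}, {p, s})`
      left
      refine ⟨fun i => ⟨g₀o q (Or.inr rfl) (by rw [hp']; exact hpq) i, g₀r i⟩, fun i => ⟨?_, g₁s i⟩⟩
      rw [← hp']; exact g₁e i
    · -- exit at `q`: `(g₀, g₁)` avoid `({p, r}, {q, s})`
      right
      refine ⟨fun i => ⟨g₀o p (Or.inl rfl) (by rw [hq']; exact hpq.symm) i, g₀r i⟩, fun i => ⟨?_, g₁s i⟩⟩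
      rw [← hq']; exact g₁e i

/-- **COLLISION LAW for reading gadgets.**  Admissibility `ok` row-wise; an `ok`-cover avoiding `{x⁰, yᵃ}` and one avoiding `{x¹, yᵇ}`
(`x⁰ ≠ yᵃ`, `x¹ ≠ yᵇ`, `x¹` covered by the first), and NO `ok`-cover avoiding the crossed pair `{x¹, yᵃ}`: then there are `ok`-covers avoiding the
collision pairs `{x⁰, x¹}` and `{yᵃ, yᵇ}` with the same total cost as the two given covers.  [folklore: alternating-path exchange; packaging
this seat] -/
theorem collision_law (ok : R → C → Prop) (cost : R → C → ℤ) (f₀ f₁ : R → C)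
    (hf₀ : Function.Injective f₀) (hf₁ : Function.Injective f₁) (hok₀ : ∀ i, ok i (f₀ i)) (hok₁ : ∀ i, ok i (f₁ i))
    (x₀ yₐ x₁ y_b : C) (hxy : x₀ ≠ yₐ) (hxy' : x₁ ≠ y_b)
    (h₀x : ∀ i, f₀ i ≠ x₀) (h₀y : ∀ i, f₀ i ≠ yₐ) (h₀sur : ∀ c, c ≠ x₀ → c ≠ yₐ → ∃ i, f₀ i = c)
    (h₁x : ∀ i, f₁ i ≠ x₁) (h₁y : ∀ i, f₁ i ≠ y_b) (hx₁ : ∃ i, f₀ i = x₁)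
    (hcross : ¬ ∃ g : R → C, Function.Injective g ∧ (∀ i, ok i (g i)) ∧ ∀ i, g i ≠ yₐ ∧ g i ≠ x₁) :
    ∃ g₀ g₁ : R → C, Function.Injective g₀ ∧ Function.Injective g₁ ∧ (∀ i, ok i (g₀ i)) ∧ (∀ i, ok i (g₁ i)) ∧
      (∀ i, g₀ i ≠ x₀ ∧ g₀ i ≠ x₁) ∧ (∀ i, g₁ i ≠ yₐ ∧ g₁ i ≠ y_b) ∧
      ∑ i, cost i (g₀ i) + ∑ i, cost i (g₁ i) = ∑ i, cost i (f₀ i) + ∑ i, cost i (f₁ i) := by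
  obtain ⟨S, hg₀, hg₁, havoid⟩ :=
    cover_exchange f₀ f₁ hf₀ hf₁ x₀ yₐ x₁ y_b hxy hxy' h₀x h₀y h₀sur h₁x h₁y hx₁
  rcases havoid with ⟨hA₀, _⟩ | ⟨hB₀, hB₁⟩
  · exact absurd ⟨_, hg₀, fun i => mix_ok ok f₀ f₁ hok₀ hok₁ S i, hA₀⟩ hcross
  · exact ⟨_, _, hg₀, hg₁, fun i => mix_ok ok f₀ f₁ hok₀ hok₁ S i, fun i => mix_ok ok f₁ f₀ hok₁ hok₀ S i,
      hB₀, hB₁, mix_cost cost f₀ f₁ S⟩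

/-- **COLLISION LAW, converse direction.**  From `ok`-covers avoiding the collision pairs `{x⁰, x¹}` (`x⁰ ≠ x¹`, covering the rest) and
`{yᵃ, yᵇ}` (`yᵃ ≠ yᵇ`), with no `ok`-cover avoiding the crossed pair `{x¹, yᵃ}`, there are `ok`-covers avoiding the intended pairs `{x⁰, yᵃ}`
and `{x¹, yᵇ}` with the same total cost.  With `collision_law`: over admissible covers, min-cost`{x⁰yᵃ}` + min-cost`{x¹yᵇ}` =
min-cost`{x⁰x¹}` + min-cost`{yᵃyᵇ}` — collisions are cost-neutral inside a reading gadget.  [folklore: alternating-path exchange; packaging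
this seat] -/
theorem collision_law_converse (ok : R → C → Prop) (cost : R → C → ℤ) (g₀ g₁ : R → C)
    (hg₀ : Function.Injective g₀) (hg₁ : Function.Injective g₁) (hok₀ : ∀ i, ok i (g₀ i)) (hok₁ : ∀ i, ok i (g₁ i))
    (x₀ yₐ x₁ y_b : C) (hxx : x₀ ≠ x₁) (hyy : yₐ ≠ y_b)
    (h₀x : ∀ i, g₀ i ≠ x₀) (h₀x' : ∀ i, g₀ i ≠ x₁) (h₀sur : ∀ c, c ≠ x₀ → c ≠ x₁ → ∃ i, g₀ i = c)
    (h₁y : ∀ i, g₁ i ≠ yₐ) (h₁y' : ∀ i, g₁ i ≠ y_b) (hyₐ : ∃ i, g₀ i = yₐ)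
    (hcross : ¬ ∃ g : R → C, Function.Injective g ∧ (∀ i, ok i (g i)) ∧ ∀ i, g i ≠ yₐ ∧ g i ≠ x₁) :
    ∃ f₀ f₁ : R → C, Function.Injective f₀ ∧ Function.Injective f₁ ∧ (∀ i, ok i (f₀ i)) ∧ (∀ i, ok i (f₁ i)) ∧
      (∀ i, f₀ i ≠ x₀ ∧ f₀ i ≠ yₐ) ∧ (∀ i, f₁ i ≠ x₁ ∧ f₁ i ≠ y_b) ∧
      ∑ i, cost i (f₀ i) + ∑ i, cost i (f₁ i) = ∑ i, cost i (g₀ i) + ∑ i, cost i (g₁ i) := by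
  obtain ⟨S, hm₀, hm₁, havoid⟩ :=
    cover_exchange g₀ g₁ hg₀ hg₁ x₀ x₁ yₐ y_b hxx hyy h₀x h₀x' h₀sur h₁y h₁y' hyₐ
  rcases havoid with ⟨hA₀, _⟩ | ⟨hB₀, hB₁⟩
  · exact absurd ⟨_, hm₀, fun i => mix_ok ok g₀ g₁ hok₀ hok₁ S i, fun i => ⟨(hA₀ i).2, (hA₀ i).1⟩⟩ hcross
  · refine ⟨_, _, hm₀, hm₁, fun i => mix_ok ok g₀ g₁ hok₀ hok₁ S i, fun i => mix_ok ok g₁ g₀ hok₁ hok₀ S i,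
      fun i => ⟨(hB₀ i).1, ?_⟩, fun i => ⟨?_, (hB₁ i).2⟩, mix_cost cost g₀ g₁ S⟩
    · exact (hB₀ i).2
    · exact (hB₁ i).1

end CoverExchange

end Summit.ValiantsHypothesis.ValiantsHypothesis.Theorems.KPlusLogSqLaw
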